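import Summits.BirchSwinnertonDyer.BirchSwinnertonDyer.Theorems.PrintCf2RubinValueTwoKatzMeasureJZeroSeamIntegralityCore
import Summits.BirchSwinnertonDyer.BirchSwinnertonDyer.Theorems.PrintCf2RubinValueTwoKatzMeasureJZeroSeamLevelConstant
import Summits.BirchSwinnertonDyer.BirchSwinnertonDyer.Theorems.PrintCf2RubinValueTwoKatzMeasureJZeroSeamValuesGlue
import Literature.NumberTheory.GaloisRepresentations.LubinTateComparisonTraceTransportTwo
import Literature.NumberTheory.EllipticCurves.DivisionPointReadings
import Literature.NumberTheory.NumberFields.RayClassFieldLocalReadingField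
import HarnessLib

/-!
# The three `𝔓`-integrality ORACLES of the `j = 0` seam, discharged (de Shalit II §4.9 (i); proofs only)

Cell `bsd-print-cf2`, width seat `bsd-line-cf2c-w4` g17; `--supports` the crux stmt-BirchSwinnertonDyer-20368 (helper, Theses-free).
THEOREMS ONLY; no `def`, no named fact, no `sorry`.

WHAT.  `KatzMeasureJZeroSeam.forall_moment_eq_of_label` ([I2] file 3a, width `-w8`) takes as HYPOTHESES three pointwise integrality
oracles on the lane curve `W = [1,−1,0,−2,−1]` with model lattice `Λ_L = Ω_E·w₀(𝓞_K)` at the split prime `v = (α₀) ∣ 2`: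
for every integral `𝔠` with `v ∤ 𝔠` and every `𝔠`-division point `z ∈ 𝔠⁻¹L ∖ L`, and every reading field `F ⊇ e(K(𝔐))`,
* `hIx`: an `X ∈ K(𝔐)` with `ι̂ X = ℘(z) − b₂/12` lies in the reading ring (`‖e X‖ ≤ 1`);
* `hIy`: a `Y ∈ K(𝔐)` with `ι̂ Y = (℘′(z) − a₁(℘(z) − b₂/12) − a₃)/2` lies in the reading ring;
* `hIu`: for two such points with `z₁ ± z₂ ∉ L`, `‖e(X₁ − X₂)‖ = 1`.
THIS FILE proves the three ∀-bodies VERBATIM (`hIx_of_lane`, `hIy_of_lane`, `hIu_of_lane`) from the frame data, over RP-INT part 2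
(`mem_readingRing_of_orbit`, `mem_readingRing_of_orbit_y`, `norm_sub_eq_one_of_readings`, p774779):
with the core (`…SeamIntegralityCore`: CM orbit of a `𝔠`-division point, orbit readings by the `[α₀]`-recursion — so `hIx` needs no
clause (vi) —, ★★ `mem_readingRing_of_mem_idealInvLattice(_y)`).  For `hIy`/`hIu` the companion coordinates come from clause (vi) of
II.1.5 (`h6`, a hypothesis of the frame) in `K(𝔣ψ𝔠)`, are read in the finite field `F ⊔ E₁ ⊇ e(K(𝔣ψ𝔠))` (`RayClassFieldLocalReadingField`)
and the bound / the unit is moved back to `F` by `norm_inclusion`.  USE (FILE-4 / FILE-3a call site): `hIx := hIx_of_lane w₀.embedding L hLE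
h₂ h₃ hv0 hw h2 u hu`, `hIy := hIy_of_lane w₀.embedding L hLE h₂ h₃ hv0 hw h2 u hu h𝔣ψ0 hv𝔣ψ h6`, `hIu := hIu_of_lane w₀.embedding L hLE h₂ h₃
hv0 hw h2 u hu e₂ h𝔣ψ0 hv𝔣ψ h6` (any `e₂ : 𝒪_v ≃+* ℤ₂`, e.g. `(integerEquivAdicCompletionIntegers v).trans (padicIntEquivOfDegreeOne K 2 v he hf)`).

ALSO (§2, the other FILE-4 socket): ★ `exists_padicIntUnit_eq_theta_mul` — the value constant `θ(a₀)·ι_p⁻¹(w₀((1−α₀)ⁿ))` of FILE-3b's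
conclusion IS `padicIntCast A₀` for a unit `A₀ ∈ ℤ₂ˣ` (the `∃ A₀ : ℤ_[2]ˣ` of [I2] v2): `(1−α₀)ⁿ ∉ v`, so it is a unit `c` of `𝒪_v`
(`exists_tateUnit_reading_of_not_mem`), `A₀ := e₂(a₀·c)`, read through `hΘe` and the reading conjugacy on `K` (`theta_algebraMap_eq_of_reading_conj`).

HONEST FRAMING: plumbing of accepted kernel theorems; nothing is closed; no summit statement is proved by this seat; BSD is not proved by any of this.

## References
* [deShalit1987] E. de Shalit, *Iwasawa theory of elliptic curves with complex multiplication* (1987), II §1.10 (p. 39), II §4.9 (i) (p. 62–63).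
* [SilvermanAEC2009] J. H. Silverman, *The Arithmetic of Elliptic Curves*, 2nd ed. (2009), VII.2.2, VII.3.1 (torsion injects into the reduction).
* [SerreLocalFields1979] J.-P. Serre, *Local Fields* (1979), Ch. II §2 (uniqueness of the extended absolute value).
-/

-- the summit namespace `Summit.BirchSwinnertonDyer.BirchSwinnertonDyer` repeats the problem name by design (D-0017)
set_option linter.dupNamespace false
set_option autoImplicit false

noncomputable section

open scoped Classical NNReal
open scoped NumberField PeriodPair
open PeriodPair Literature.NumberTheory.EllipticCurves Literature.NumberTheory.EllipticCurves.DeShalit1987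
  Literature.NumberTheory.EllipticCurves.DivisionPointReadings
open NumberField Field IsDedekindDomain IsDedekindDomain.HeightOneSpectrum ValuativeRel
open Literature.NumberTheory.NumberFields Literature.NumberTheory.ComplexMultiplication.EllipticUnits
open Literature.NumberTheory.GaloisRepresentations Literature.NumberTheory.GaloisRepresentations.IsNonarchimedeanLocalField
  Literature.NumberTheory.GaloisRepresentations.LubinTate
open Polynomial _root_.WeierstrassCurve Literature.NumberTheory.PAdicHodge

namespace Summit.BirchSwinnertonDyer.BirchSwinnertonDyer.Theorems.PrintCf2.KatzMeasureJZeroSeam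

attribute [local instance] ltNormUniformSpace ltNormIsUniformAddGroup rk1 nF nE fintypeResidueField

variable {K : Type} [Field K] [NumberField K]

/-! ## The three oracles of `forall_moment_eq_of_label`, discharged -/

section Oracles

variable {v : HeightOneSpectrum (𝓞 K)} {α₀ : 𝓞 K}
  (ι : K →+* ℂ) (L : PeriodPair) {ΩE : ℂ} (hLE : ∀ z : ℂ, z ∈ L.lattice ↔ ∃ a : 𝓞 K, z = ΩE * ι (a : K))
  (h₂ : L.g₂ = (((⟨1, -1, 0, -2, -1⟩ : WeierstrassCurve ℤ)).baseChange ℂ).c₄ / 12)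
  (h₃ : L.g₃ = (((⟨1, -1, 0, -2, -1⟩ : WeierstrassCurve ℤ)).baseChange ℂ).c₆ / 216)

include hLE h₂ h₃ in
/-- ★★★ **ORACLE `hIx` DISCHARGED** — the ∀-body of the hypothesis `hIx` of `forall_moment_eq_of_label` VERBATIM: for `v = (α₀) ∤ 𝔠 ≠ 0`,
`z ∈ 𝔠⁻¹L ∖ L` and any reading field `F ⊇ e(K(𝔐))`, an `X ∈ K(𝔐)` reading `x(ξ z) = ℘(z) − b₂/12` lies in the reading ring.
No clause (vi) is used: the orbit readings are generated from `X` (§2). [cite: deShalit1987, II §4.9 (i) (p. 62–63)]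
[cite: SilvermanAEC2009, VII.3.1] -/
theorem hIx_of_lane (hv0 : v.asIdeal = Ideal.span {α₀}) (hw : ι (α₀ : K) ^ 2 = ι (α₀ : K) - 2)
    (h2 : (valuation (v.adicCompletion K)).IsUniformizer ((((2 : ℕ) : 𝒪[v.adicCompletion K]) : v.adicCompletion K)))
    (u : 𝒪[v.adicCompletion K]ˣ)
    (hu : ((((u : 𝒪[v.adicCompletion K]) * ((2 : ℕ) : 𝒪[v.adicCompletion K]) : 𝒪[v.adicCompletion K]) : v.adicCompletion K)) =
      ((α₀ : K) : v.adicCompletion K)) :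
    ∀ (𝔠 : Ideal (𝓞 K)), 𝔠 ≠ ⊥ → ¬ 𝔠 ≤ v.asIdeal → ∀ z : ℂ, z ∈ idealInvLattice ι 𝔠 L.lattice → z ∉ L.lattice →
      ∀ {𝔐 : Ideal (𝓞 K)} (F : IntermediateField (v.adicCompletion K) (AlgebraicClosure (v.adicCompletion K)))
        [FiniteDimensional (v.adicCompletion K) F]
        (hF : ∀ y : AlgebraicClosure K, y ∈ rayClassField K 𝔐 → absClosureEmbedding K (v.adicCompletion K) y ∈ F) (X : rayClassField K 𝔐),
        algClosureEmb ι X = ℘[L] z - (((⟨1, -1, 0, -2, -1⟩ : WeierstrassCurve ℤ)).baseChange ℂ).b₂ / 12 → X ∈ readingRing F hF := by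
  intro 𝔠 h𝔠 h𝔠v z hz hzL 𝔐 F _ hF X hX
  rw [modelX_eq] at hX
  exact mem_readingRing_of_mem_idealInvLattice ι F hF hv0 hw (norm_two_lt_one_of_isUniformizer v h2 F)
    (norm_readingFieldHom_algebraMap_lt_one v h2 u hu F hF) L hLE (g₂_eq_of_cm7 L h₂) (g₃_eq_of_cm7 L h₃) h𝔠 h𝔠v hz hzL X hX

include hLE h₂ h₃ in
/-- ★★★ **ORACLE `hIy` DISCHARGED** — the ∀-body of the hypothesis `hIy` of `forall_moment_eq_of_label` VERBATIM: a `Y ∈ K(𝔐)` reading the model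
`y`-coordinate `(℘′(z) − a₁(℘(z) − b₂/12) − a₃)/2` of a `𝔠`-division point (`v ∤ 𝔠`) lies in the reading ring.  The companion
`x`-coordinate comes from clause (vi) of II.1.5 (`h6`) in `K(𝔣ψ𝔠)`; both are read in `F ⊔ E₁ ⊇ e(K(𝔣ψ𝔠))` and the bound is moved back to
`F` by `norm_inclusion`. [cite: deShalit1987, II §1.5 (15), II §4.9 (i) (p. 62–63)] [cite: SilvermanAEC2009, VII.3.1] -/
theorem hIy_of_lane (hv0 : v.asIdeal = Ideal.span {α₀}) (hw : ι (α₀ : K) ^ 2 = ι (α₀ : K) - 2)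
    (h2 : (valuation (v.adicCompletion K)).IsUniformizer ((((2 : ℕ) : 𝒪[v.adicCompletion K]) : v.adicCompletion K)))
    (u : 𝒪[v.adicCompletion K]ˣ)
    (hu : ((((u : 𝒪[v.adicCompletion K]) * ((2 : ℕ) : 𝒪[v.adicCompletion K]) : 𝒪[v.adicCompletion K]) : v.adicCompletion K)) =
      ((α₀ : K) : v.adicCompletion K))
    {𝔣ψ : Ideal (𝓞 K)} (h𝔣ψ0 : 𝔣ψ ≠ ⊥) (hv𝔣ψ : ¬ 𝔣ψ ≤ v.asIdeal)
    (h6 : ∀ 𝔠 : Ideal (𝓞 K), 𝔠 ≠ ⊥ → ∀ z : ℂ, z ∈ idealInvLattice ι 𝔠 L.lattice → z ∉ L.lattice →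
      ∃ x y : rayClassField K (𝔣ψ * 𝔠), algClosureEmb ι x = ℘[L] z ∧ algClosureEmb ι y = ℘'[L] z) :
    ∀ (𝔠 : Ideal (𝓞 K)), 𝔠 ≠ ⊥ → ¬ 𝔠 ≤ v.asIdeal → ∀ z : ℂ, z ∈ idealInvLattice ι 𝔠 L.lattice → z ∉ L.lattice →
      ∀ {𝔐 : Ideal (𝓞 K)} (F : IntermediateField (v.adicCompletion K) (AlgebraicClosure (v.adicCompletion K)))
        [FiniteDimensional (v.adicCompletion K) F]
        (hF : ∀ y : AlgebraicClosure K, y ∈ rayClassField K 𝔐 → absClosureEmbedding K (v.adicCompletion K) y ∈ F) (Y : rayClassField K 𝔐),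
        algClosureEmb ι Y = (℘'[L] z - (((⟨1, -1, 0, -2, -1⟩ : WeierstrassCurve ℤ)).baseChange ℂ).a₁ *
          (℘[L] z - (((⟨1, -1, 0, -2, -1⟩ : WeierstrassCurve ℤ)).baseChange ℂ).b₂ / 12) - (((⟨1, -1, 0, -2, -1⟩ : WeierstrassCurve ℤ)).baseChange ℂ).a₃) / 2 →
        Y ∈ readingRing F hF := by
  intro 𝔠 h𝔠 h𝔠v z hz hzL 𝔐 F _ hF Y hY
  rw [modelY_eq] at hY
  -- companion coordinates from clause (vi), in `K(𝔣ψ𝔠)`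
  obtain ⟨x, y, hx, hy⟩ := h6 𝔠 h𝔠 z hz hzL
  -- the complex reading `φ = ι̂ ∘ (K(𝔣ψ𝔠) ⊂ K̄)` and the model coordinates `X' = x + ¼`, `Y' = (y − X')/2`
  have hφc : ∀ t : K, ((algClosureEmb ι).comp (algebraMap (rayClassField K (𝔣ψ * 𝔠)) (AlgebraicClosure K)))
      (algebraMap K (rayClassField K (𝔣ψ * 𝔠)) t) = ι t := fun t ↦ by
    rw [RingHom.comp_apply, ← IsScalarTower.algebraMap_apply, algClosureEmb_algebraMap]
  have hφx : ((algClosureEmb ι).comp (algebraMap (rayClassField K (𝔣ψ * 𝔠)) (AlgebraicClosure K))) x = ℘[L] z := hx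
  have hφy : ((algClosureEmb ι).comp (algebraMap (rayClassField K (𝔣ψ * 𝔠)) (AlgebraicClosure K))) y = ℘'[L] z := hy
  have hX'φ : ((algClosureEmb ι).comp (algebraMap (rayClassField K (𝔣ψ * 𝔠)) (AlgebraicClosure K)))
      (x + algebraMap K (rayClassField K (𝔣ψ * 𝔠)) (1 / 4 : K)) = ℘[L] z + 1 / 4 := by
    rw [map_add, hφx, hφc, map_div₀, map_one, map_ofNat]
  have hY'φ : ((algClosureEmb ι).comp (algebraMap (rayClassField K (𝔣ψ * 𝔠)) (AlgebraicClosure K)))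
      ((y - (x + algebraMap K (rayClassField K (𝔣ψ * 𝔠)) (1 / 4 : K))) / 2) = (℘'[L] z - (℘[L] z + 1 / 4)) / 2 := by
    rw [map_div₀, map_sub, hφy, hX'φ, map_ofNat]
  have hX' : algClosureEmb ι ((x + algebraMap K (rayClassField K (𝔣ψ * 𝔠)) (1 / 4 : K) : rayClassField K (𝔣ψ * 𝔠)) :
      AlgebraicClosure K) = ℘[L] z + 1 / 4 := hX'φ
  have hY' : algClosureEmb ι (((y - (x + algebraMap K (rayClassField K (𝔣ψ * 𝔠)) (1 / 4 : K))) / 2 : rayClassField K (𝔣ψ * 𝔠)) :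
      AlgebraicClosure K) = (℘'[L] z - (℘[L] z + 1 / 4)) / 2 := hY'φ
  obtain ⟨X', Y', hX', hY'⟩ : ∃ X' Y' : rayClassField K (𝔣ψ * 𝔠), algClosureEmb ι X' = ℘[L] z + 1 / 4 ∧
      algClosureEmb ι Y' = (℘'[L] z - (℘[L] z + 1 / 4)) / 2 := ⟨_, _, hX', hY'⟩
  -- the reading field `F ⊔ E₁ ⊇ e(K(𝔣ψ𝔠))`
  have hne : 𝔣ψ * 𝔠 ≠ ⊥ := mul_ne_zero h𝔣ψ0 h𝔠
  have hnle : ¬ 𝔣ψ * 𝔠 ≤ v.asIdeal := fun h ↦ (v.isPrime.mul_le.mp h).elim hv𝔣ψ h𝔠v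
  obtain ⟨E₁, hfd₁, -, -, hE₁⟩ := exists_finite_galois_le_maxUnramified_forall_mem_rayClassField (K := K) (v := v) hne hnle
  haveI := hfd₁
  haveI : FiniteDimensional (v.adicCompletion K) (F ⊔ E₁ : IntermediateField (v.adicCompletion K) (AlgebraicClosure (v.adicCompletion K))) :=
    IntermediateField.finiteDimensional_sup F E₁
  have hF' : ∀ yy : AlgebraicClosure K, yy ∈ rayClassField K (𝔣ψ * 𝔠) →
      absClosureEmbedding K (v.adicCompletion K) yy ∈ (F ⊔ E₁ : IntermediateField (v.adicCompletion K) (AlgebraicClosure (v.adicCompletion K))) :=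
    fun yy hyy ↦ (le_sup_right : E₁ ≤ F ⊔ E₁) (hE₁ yy hyy)
  -- integrality of `Y'` read in `F ⊔ E₁`
  have hY'i : Y' ∈ readingRing (F ⊔ E₁) hF' :=
    mem_readingRing_of_mem_idealInvLattice_y ι (F ⊔ E₁) hF' hv0 hw (norm_two_lt_one_of_isUniformizer v h2 _)
      (norm_readingFieldHom_algebraMap_lt_one v h2 u hu _ hF') L hLE (g₂_eq_of_cm7 L h₂) (g₃_eq_of_cm7 L h₃) h𝔠 h𝔠v hz hzL hX' hY'
  -- `Y` and `Y'` are the same algebraic number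
  have hYY' : (Y : AlgebraicClosure K) = (Y' : AlgebraicClosure K) := (algClosureEmb ι).injective (hY.trans hY'.symm)
  -- transfer along `F ≤ F ⊔ E₁`
  rw [mem_readingRing_iff]
  have hincl : IntermediateField.inclusion (le_sup_left : F ≤ F ⊔ E₁) (readingFieldHom F hF Y) = readingFieldHom (F ⊔ E₁) hF' Y' := by
    apply Subtype.ext
    change ((readingFieldHom F hF Y : F) : AlgebraicClosure (v.adicCompletion K)) = _
    rw [coe_readingFieldHom, coe_readingFieldHom, hYY']
  rw [← norm_inclusion (le_sup_left : F ≤ F ⊔ E₁), hincl]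
  exact (mem_readingRing_iff _ _ _).mp hY'i

include hLE h₂ h₃ in
/-- ★★★ **ORACLE `hIu` DISCHARGED** — the ∀-body of the hypothesis `hIu` of `forall_moment_eq_of_label` VERBATIM: for two `𝔠`-division points
`z₁, z₂ ∈ 𝔠⁻¹L ∖ L` (`v ∤ 𝔠`) with `z₁ ± z₂ ∉ L` and `X₁, X₂ ∈ K(𝔐)` reading their model `x`-coordinates, `‖e(X₁ − X₂)‖ = 1`
(de Shalit II §4.9 (i): «`℘(Ω) − ℘(v)` is a `𝔓`-unit»).  The eight companion readings of `ξ(z₁), ξ(z₂), ξ(z₁ ∓ z₂)` come from clause (vi)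
(`h6`) in `K(𝔣ψ𝔠)`, their `x`-coordinates are integral by §3, and `norm_sub_eq_one_of_readings` (RP-INT) runs in `F ⊔ E₁`; back to `F` by
`norm_inclusion`. [cite: deShalit1987, II §1.5 (15), II §4.9 (i) (p. 62–63)] [cite: SilvermanAEC2009, VII.2.1, VII.3.1] -/
theorem hIu_of_lane (hv0 : v.asIdeal = Ideal.span {α₀}) (hw : ι (α₀ : K) ^ 2 = ι (α₀ : K) - 2)
    (h2 : (valuation (v.adicCompletion K)).IsUniformizer ((((2 : ℕ) : 𝒪[v.adicCompletion K]) : v.adicCompletion K)))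
    (u : 𝒪[v.adicCompletion K]ˣ)
    (hu : ((((u : 𝒪[v.adicCompletion K]) * ((2 : ℕ) : 𝒪[v.adicCompletion K]) : 𝒪[v.adicCompletion K]) : v.adicCompletion K)) =
      ((α₀ : K) : v.adicCompletion K))
    (e₂ : 𝒪[v.adicCompletion K] ≃+* ℤ_[2])
    {𝔣ψ : Ideal (𝓞 K)} (h𝔣ψ0 : 𝔣ψ ≠ ⊥) (hv𝔣ψ : ¬ 𝔣ψ ≤ v.asIdeal)
    (h6 : ∀ 𝔠 : Ideal (𝓞 K), 𝔠 ≠ ⊥ → ∀ z : ℂ, z ∈ idealInvLattice ι 𝔠 L.lattice → z ∉ L.lattice →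
      ∃ x y : rayClassField K (𝔣ψ * 𝔠), algClosureEmb ι x = ℘[L] z ∧ algClosureEmb ι y = ℘'[L] z) :
    ∀ (𝔠 : Ideal (𝓞 K)), 𝔠 ≠ ⊥ → ¬ 𝔠 ≤ v.asIdeal → ∀ z₁ z₂ : ℂ, z₁ ∈ idealInvLattice ι 𝔠 L.lattice →
      z₂ ∈ idealInvLattice ι 𝔠 L.lattice → z₁ ∉ L.lattice → z₂ ∉ L.lattice → z₁ - z₂ ∉ L.lattice → z₁ + z₂ ∉ L.lattice →
      ∀ {𝔐 : Ideal (𝓞 K)} (F : IntermediateField (v.adicCompletion K) (AlgebraicClosure (v.adicCompletion K)))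
        [FiniteDimensional (v.adicCompletion K) F]
        (hF : ∀ y : AlgebraicClosure K, y ∈ rayClassField K 𝔐 → absClosureEmbedding K (v.adicCompletion K) y ∈ F) (X₁ X₂ : rayClassField K 𝔐),
        algClosureEmb ι X₁ = ℘[L] z₁ - (((⟨1, -1, 0, -2, -1⟩ : WeierstrassCurve ℤ)).baseChange ℂ).b₂ / 12 →
        algClosureEmb ι X₂ = ℘[L] z₂ - (((⟨1, -1, 0, -2, -1⟩ : WeierstrassCurve ℤ)).baseChange ℂ).b₂ / 12 →
        ‖(readingFieldHom F hF (X₁ - X₂) : F)‖ = 1 := by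
  intro 𝔠 h𝔠 h𝔠v z₁ z₂ hz₁ hz₂ hz₁L hz₂L hm hp 𝔐 F _ hF X₁ X₂ hX₁ hX₂
  have hzm : z₁ - z₂ ∈ idealInvLattice ι 𝔠 L.lattice := sub_mem hz₁ hz₂
  have hzp : z₁ + z₂ ∈ idealInvLattice ι 𝔠 L.lattice := add_mem hz₁ hz₂
  -- the eight companion readings from clause (vi), as elements of `Kb := K(𝔣ψ𝔠)`
  obtain ⟨x₁, y₁, hx₁F, hy₁F, hx₁, hy₁⟩ := exists_model_coords_mem_rayClassField ι L (⟨1, -1, 0, -2, -1⟩ : WeierstrassCurve ℤ) h6 h𝔠 hz₁ hz₁L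
  obtain ⟨x₂, y₂, hx₂F, hy₂F, hx₂, hy₂⟩ := exists_model_coords_mem_rayClassField ι L (⟨1, -1, 0, -2, -1⟩ : WeierstrassCurve ℤ) h6 h𝔠 hz₂ hz₂L
  obtain ⟨xm, ym, hxmF, hymF, hxm, hym⟩ := exists_model_coords_mem_rayClassField ι L (⟨1, -1, 0, -2, -1⟩ : WeierstrassCurve ℤ) h6 h𝔠 hzm hm
  obtain ⟨xp, yp, hxpF, hypF, hxp, hyp⟩ := exists_model_coords_mem_rayClassField ι L (⟨1, -1, 0, -2, -1⟩ : WeierstrassCurve ℤ) h6 h𝔠 hzp hp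
  -- the reading field `F ⊔ E₁ ⊇ e(K(𝔣ψ𝔠))`
  have hne : 𝔣ψ * 𝔠 ≠ ⊥ := mul_ne_zero h𝔣ψ0 h𝔠
  have hnle : ¬ 𝔣ψ * 𝔠 ≤ v.asIdeal := fun h ↦ (v.isPrime.mul_le.mp h).elim hv𝔣ψ h𝔠v
  obtain ⟨E₁, hfd₁, -, -, hE₁⟩ := exists_finite_galois_le_maxUnramified_forall_mem_rayClassField (K := K) (v := v) hne hnle
  haveI := hfd₁
  haveI : FiniteDimensional (v.adicCompletion K) (F ⊔ E₁ : IntermediateField (v.adicCompletion K) (AlgebraicClosure (v.adicCompletion K))) :=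
    IntermediateField.finiteDimensional_sup F E₁
  have hF' : ∀ yy : AlgebraicClosure K, yy ∈ rayClassField K (𝔣ψ * 𝔠) →
      absClosureEmbedding K (v.adicCompletion K) yy ∈ (F ⊔ E₁ : IntermediateField (v.adicCompletion K) (AlgebraicClosure (v.adicCompletion K))) :=
    fun yy hyy ↦ (le_sup_right : E₁ ≤ F ⊔ E₁) (hE₁ yy hyy)
  -- integrality of the four `x`-coordinates (§3)
  have hg₂ := g₂_eq_of_cm7 L h₂
  have hg₃ := g₃_eq_of_cm7 L h₃
  have h2M := norm_two_lt_one_of_isUniformizer v h2 (F ⊔ E₁ : IntermediateField (v.adicCompletion K) (AlgebraicClosure (v.adicCompletion K)))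
  have hπM := norm_readingFieldHom_algebraMap_lt_one v h2 u hu _ hF'
  have hint : ∀ {w : ℂ} (hw' : w ∈ idealInvLattice ι 𝔠 L.lattice) (hwL : w ∉ L.lattice) {xx : AlgebraicClosure K}
      (hxxF : xx ∈ rayClassField K (𝔣ψ * 𝔠))
      (hxx : algClosureEmb ι xx = ℘[L] w - (((⟨1, -1, 0, -2, -1⟩ : WeierstrassCurve ℤ)).baseChange ℂ).b₂ / 12),
      ‖(readingFieldHom (F ⊔ E₁) hF' ⟨xx, hxxF⟩ : (F ⊔ E₁ : IntermediateField (v.adicCompletion K) (AlgebraicClosure (v.adicCompletion K))))‖ ≤ 1 := by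
    intro w hw' hwL xx hxxF hxx
    rw [modelX_eq] at hxx
    exact (mem_readingRing_iff _ _ _).mp
      (mem_readingRing_of_mem_idealInvLattice ι (F ⊔ E₁) hF' hv0 hw h2M hπM L hLE hg₂ hg₃ h𝔠 h𝔠v hw' hwL ⟨xx, hxxF⟩ hxx)
  -- RP-INT `norm_sub_eq_one_of_readings` in `M := F ⊔ E₁`, `Kb := K(𝔣ψ𝔠)`
  have key := norm_sub_eq_one_of_readings (e := e₂)
    (M := (F ⊔ E₁ : IntermediateField (v.adicCompletion K) (AlgebraicClosure (v.adicCompletion K))))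
    (ιc := (algClosureEmb ι).comp (algebraMap (rayClassField K (𝔣ψ * 𝔠)) (AlgebraicClosure K)))
    (ιv := (absClosureEmbedding K (v.adicCompletion K)).toRingHom.comp (algebraMap (rayClassField K (𝔣ψ * 𝔠)) (AlgebraicClosure K)))
    L h₂ h₃ h2M hz₁L hz₂L hm hp
    (xΩ := ⟨x₁, hx₁F⟩) (yΩ := ⟨y₁, hy₁F⟩) (xc := ⟨x₂, hx₂F⟩) (yc := ⟨y₂, hy₂F⟩)
    (xm := ⟨xm, hxmF⟩) (ym := ⟨ym, hymF⟩) (xp := ⟨xp, hxpF⟩) (yp := ⟨yp, hypF⟩)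
    hx₁ hy₁ hx₂ hy₂ hxm hym hxp hyp
    (XΩ := readingFieldHom (F ⊔ E₁) hF' ⟨x₁, hx₁F⟩) (YΩ := readingFieldHom (F ⊔ E₁) hF' ⟨y₁, hy₁F⟩)
    (XC := readingFieldHom (F ⊔ E₁) hF' ⟨x₂, hx₂F⟩) (YC := readingFieldHom (F ⊔ E₁) hF' ⟨y₂, hy₂F⟩)
    (XM := readingFieldHom (F ⊔ E₁) hF' ⟨xm, hxmF⟩) (YM := readingFieldHom (F ⊔ E₁) hF' ⟨ym, hymF⟩)
    (XP := readingFieldHom (F ⊔ E₁) hF' ⟨xp, hxpF⟩) (YP := readingFieldHom (F ⊔ E₁) hF' ⟨yp, hypF⟩)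
    rfl rfl rfl rfl rfl rfl rfl rfl
    (hint hz₁ hz₁L hx₁F hx₁) (hint hz₂ hz₂L hx₂F hx₂) (hint hzm hm hxmF hxm) (hint hzp hp hxpF hxp)
  -- `X₁ = x₁`, `X₂ = x₂` in `K̄`
  have hX₁x : (X₁ : AlgebraicClosure K) = x₁ := (algClosureEmb ι).injective (hX₁.trans hx₁.symm)
  have hX₂x : (X₂ : AlgebraicClosure K) = x₂ := (algClosureEmb ι).injective (hX₂.trans hx₂.symm)
  have hincl : IntermediateField.inclusion (le_sup_left : F ≤ F ⊔ E₁) (readingFieldHom F hF (X₁ - X₂)) =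
      readingFieldHom (F ⊔ E₁) hF' ⟨x₁, hx₁F⟩ - readingFieldHom (F ⊔ E₁) hF' ⟨x₂, hx₂F⟩ := by
    rw [map_sub, map_sub]
    congr 1
    · apply Subtype.ext
      change ((readingFieldHom F hF X₁ : F) : AlgebraicClosure (v.adicCompletion K)) = _
      rw [coe_readingFieldHom, coe_readingFieldHom, hX₁x]
    · apply Subtype.ext
      change ((readingFieldHom F hF X₂ : F) : AlgebraicClosure (v.adicCompletion K)) = _
      rw [coe_readingFieldHom, coe_readingFieldHom, hX₂x]
  rw [← norm_inclusion (le_sup_left : F ≤ F ⊔ E₁), hincl]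
  exact key

end Oracles

/-! ## §2 The value constant of [I2] is a `2`-adic unit -/

section UnitConstant

variable {v : HeightOneSpectrum (𝓞 K)}

omit [NumberField K] in
/-- `(1 − α₀)ⁿ ∉ v` for `v = (α₀)` (else `1 ∈ v`). [cite: deShalit1987, II §4.9 (ii)] -/
theorem one_sub_pow_notMem [NumberField K] {α₀ : 𝓞 K} (hv0 : v.asIdeal = Ideal.span {α₀}) (n : ℕ) :
    ((1 - α₀) ^ n : 𝓞 K) ∉ v.asIdeal := by
  intro h
  have h1 : (1 - α₀ : 𝓞 K) ∈ v.asIdeal := v.isPrime.mem_of_pow_mem n h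
  have hα : α₀ ∈ v.asIdeal := by rw [hv0]; exact Ideal.mem_span_singleton_self α₀
  have h1' : (1 : 𝓞 K) ∈ v.asIdeal := by simpa using v.asIdeal.add_mem h1 hα
  exact v.isPrime.ne_top ((Ideal.eq_top_iff_one _).mpr h1')

/-- ★ **The value constant is `padicIntCast` of a `2`-adic unit**: for the Tate unit `a₀ ∈ 𝒪_vˣ`, `v = (α₀)` of degree one, a reading
`θ : ℂ_v → ℂ₂` conjugate to `ι_p` through `τ_K` (Q-θ) and compatible with `e₂ : 𝒪_v ≃ ℤ₂` on integers (`hΘe`), there is `A₀ ∈ ℤ₂ˣ` with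
`padicIntCast A₀ = θ(a₀)·ι_p⁻¹(w₀((1 − α₀)ⁿ))` — the `∃ A₀ : ℤ_[2]ˣ` of [I2] v2 for FILE-3b's value constant (`n = 3`).
[cite: deShalit1987, II §4.9 (ii), II §4.14 (38) (p. 71)] [cite: FrohlichTaylor1990, Ch. III §1 (1.14)(a)] -/
theorem exists_padicIntUnit_eq_theta_mul [v.asIdeal.LiesOver (ratPlace 2).asIdeal]
    (he : v.asIdeal.ramificationIdx (𝓞 ℚ) = 1) (hf : v.asIdeal.inertiaDeg (𝓞 ℚ) = 1)
    {α₀ : 𝓞 K} (hv0 : v.asIdeal = Ideal.span {α₀})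
    (θ : CompletedAlgClosure (v.adicCompletion K) →+* ℂ_[2]) (ιp : PadicAlgCl 2 ≃+* ℂ) (w₀ : InfinitePlace K) {τK : absoluteGaloisGroup K}
    (hτK : ∀ x : AlgebraicClosure K,
      θ (algClosureToC (v.adicCompletion K) (absClosureEmbedding K (v.adicCompletion K) (τK • x))) =
        algebraMap (PadicAlgCl 2) ℂ_[2] (ιp.symm (algClosureEmb w₀.embedding x)))
    (e₂ : v.adicCompletionIntegers K ≃+* ℤ_[2])
    (hΘe : ∀ a : 𝒪[v.adicCompletion K], (θ.comp ((CBall (v.adicCompletion K)).subtype.comp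
        (algebraMap (UnrCoeff (v.adicCompletion K)) (CBall (v.adicCompletion K))))) (intToUnrCoeff (v.adicCompletion K) a) =
      padicIntCast ℂ_[2] (((e₂ : v.adicCompletionIntegers K →+* ℤ_[2]).comp (integerEquivAdicCompletionIntegers v).toRingHom) a))
    (a₀ : 𝒪[v.adicCompletion K]ˣ) (n : ℕ) :
    ∃ A₀ : ℤ_[2]ˣ, padicIntCast ℂ_[2] ((A₀ : ℤ_[2]ˣ) : ℤ_[2]) =
      θ (algebraMap (v.adicCompletion K) (CompletedAlgClosure (v.adicCompletion K)) ((a₀ : 𝒪[v.adicCompletion K]) : v.adicCompletion K)) *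
        algebraMap (PadicAlgCl 2) ℂ_[2] (ιp.symm (w₀.embedding (((1 - α₀) ^ n : 𝓞 K) : K))) := by
  obtain ⟨c, hc, -⟩ := exists_tateUnit_reading_of_not_mem he hf (one_sub_pow_notMem hv0 n)
  refine ⟨Units.map (((e₂ : v.adicCompletionIntegers K →+* ℤ_[2]).comp (integerEquivAdicCompletionIntegers v).toRingHom).toMonoidHom)
    (a₀ * c), ?_⟩
  change padicIntCast ℂ_[2] ((((e₂ : v.adicCompletionIntegers K →+* ℤ_[2]).comp (integerEquivAdicCompletionIntegers v).toRingHom))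
    (((a₀ * c : 𝒪[v.adicCompletion K]ˣ) : 𝒪[v.adicCompletion K]))) = _
  rw [← hΘe, RingHom.comp_apply, RingHom.comp_apply, Subring.subtype_apply,
    coe_algebraMap_intToUnrCoeff, Units.val_mul, Subring.coe_mul, map_mul, map_mul, hc,
    ← theta_algebraMap_eq_of_reading_conj θ ιp w₀ hτK (((1 - α₀) ^ n : 𝓞 K) : K)]
  rfl

end UnitConstant

end Summit.BirchSwinnertonDyer.BirchSwinnertonDyer.Theorems.PrintCf2.KatzMeasureJZeroSeam

end
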